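import Mathlib

/-!
# Injectivity from the coincidence structure of double points

Helper file for stub `helper_injectiveOfCoincidenceStructure` of line `Sketch`, crux
`TameOrBrodyR4` (stmt-SmoothPoincare4-7826, route SullivanDual), skeleton v16.

The global, purely topological step in the injectivity of immersed limits of embedded members
of Gromov's pencil on `ℝ⁴`.  Let `v : ℂ → ℝ⁴` be continuous, proper at infinity
(`P (v ξ) - ξ → 0` for a linear `P : ℝ⁴ → ℂ`), injective over the far lines (`P (v ξ) = c` has a
unique solution for `2R < ‖c‖`), locally injective, and such that every double value
`v ξa = v ξb` at distinct parameters comes with a local coincidence of sheets: a continuous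
reparametrisation `σ` near `ξb` with `v = v ∘ σ` there and `σ ξb = ξa`.  Then `v` is injective.

Proof.  Let `A` be the set of parameters `ξ` having a partner `ξ' ≠ ξ` whose sheet locally
coincides with the sheet through `ξ`.
* `A` is open: the reparametrisation `σ` witnessing `ξ ∈ A` witnesses `η ∈ A` for `η` near `ξ`,
  with partner `σ η ≠ η` (as `σ ξ = ξ' ≠ ξ` and `σ` is continuous at `ξ`).
* `A` is closed: if `ξ k ∈ A` converge to `ξs`, the partners `ξ' k` (same values, `ξ' k ≠ ξ k`)
  are bounded by properness, so subconverge to some `ξs'` with `v ξs' = v ξs`; local injectivity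
  at `ξs` forces `ξs' ≠ ξs`, and the coincidence hypothesis puts `ξs ∈ A`.
* a double point of `v` puts a point in `A`.
By connectedness of `ℂ`, a double point forces `A = ℂ`; but a far parameter `t` (with
`2R < ‖P (v t)‖`) has no partner, by injectivity over the far line `P = P (v t)`.
-/

set_option linter.dupNamespace false

noncomputable section

open Filter Set Metric
open scoped Topology

namespace Summit.SmoothPoincare4.SmoothPoincare4.Cruxes.TameOrBrodyR4.Sketch

/-- Local notation for the model space `ℝ⁴ = EuclideanSpace ℝ (Fin 4)`. -/
local notation "E4" => EuclideanSpace ℝ (Fin 4)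

namespace InjCoincide

/-- From `f η - η → 0` along `cocompact ℂ`, a positive radius beyond which `‖f η - η‖ < 1`. -/
theorem exists_radius_tail (f : ℂ → ℂ)
    (hnorm : Tendsto (fun η => f η - η) (cocompact ℂ) (𝓝 0)) :
    ∃ ρ : ℝ, 0 < ρ ∧ ∀ η : ℂ, ρ ≤ ‖η‖ → ‖f η - η‖ < 1 := by
  have h1 : ∀ᶠ η in cocompact ℂ, ‖f η - η‖ < 1 := by
    have := (Metric.tendsto_nhds.1 hnorm) 1 one_pos
    simpa only [dist_zero_right] using this
  rw [← Metric.cobounded_eq_cocompact, ← comap_norm_atTop, eventually_comap] at h1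
  obtain ⟨r, hr⟩ := eventually_atTop.1 h1
  exact ⟨max r 1, lt_of_lt_of_le one_pos (le_max_right _ _),
    fun η hη => hr _ ((le_max_left _ _).trans hη) _ rfl⟩

/-- The tail estimate `‖f η - η‖ < 1` for `ρ ≤ ‖η‖` bounds every parameter by its value:
`‖η‖ ≤ max ρ (‖f η‖ + 1)`. -/
theorem norm_le_max_of_tail (f : ℂ → ℂ) (ρ : ℝ)
    (hρ : ∀ η : ℂ, ρ ≤ ‖η‖ → ‖f η - η‖ < 1) (η : ℂ) :
    ‖η‖ ≤ max ρ (‖f η‖ + 1) := by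
  rcases le_or_gt ρ ‖η‖ with h | h
  · have h1 := hρ η h
    have h2 : ‖η‖ - ‖f η‖ ≤ ‖η - f η‖ := norm_sub_norm_le _ _
    rw [norm_sub_rev] at h2
    exact le_max_of_le_right (by linarith)
  · exact le_max_of_le_left h.le

/-- The coincidence set (parameters `ξ` with a partner `ξ' ≠ ξ` whose sheet coincides with the
sheet through `ξ` near `ξ`, via a continuous reparametrisation `σ`, `σ ξ = ξ'`) is open: the same
`σ` and neighbourhood work at every `η ∈ N` near `ξ`, with partner `σ η`, and `σ η ≠ η` near `ξ`
since `σ ξ ≠ ξ`. -/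
theorem isOpen_coincideSet {α : Type*} (v : ℂ → α) :
    IsOpen {ξ : ℂ | ∃ (ξ' : ℂ) (σ : ℂ → ℂ) (N : Set ℂ), ξ' ≠ ξ ∧ IsOpen N ∧ ξ ∈ N ∧
      ContinuousOn σ N ∧ (∀ ζ ∈ N, v ζ = v (σ ζ)) ∧ σ ξ = ξ'} := by
  rw [isOpen_iff_mem_nhds]
  rintro ξ ⟨ξ', σ, N, hne, hN, hξN, hσ, hv, hσξ⟩
  have hcont : ContinuousAt σ ξ := hσ.continuousAt (hN.mem_nhds hξN)
  have h3 : ∀ᶠ η in 𝓝 ξ, σ η ≠ id η :=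
    (hcont.ne_iff_eventually_ne continuousAt_id).1 (by rw [hσξ]; exact hne)
  filter_upwards [h3, hN.mem_nhds hξN] with η hη hηN
  exact ⟨σ η, σ, N, hη, hN, hηN, hσ, hv, rfl⟩

/-- The coincidence set is closed (sequentially): if `ξ k ∈ A` converge to `ξs`, the partners
`ξ' k ≠ ξ k` have the same values, are bounded (tail estimate), hence subconverge to some `ξs'`
with `v ξs' = v ξs`; local injectivity at `ξs` rules out `ξs' = ξs`, and then the coincidence
hypothesis for the distinct pair `(ξs', ξs)` puts `ξs` in the set. -/
theorem isClosed_coincideSet (v : ℂ → E4) (hvc : Continuous v) (P : E4 →L[ℝ] ℂ) (ρ : ℝ)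
    (hρ : ∀ η : ℂ, ρ ≤ ‖η‖ → ‖P (v η) - η‖ < 1)
    (hli : ∀ ξ : ℂ, ∃ r : ℝ, 0 < r ∧ InjOn v (closedBall ξ r))
    (h2 : ∀ ξa ξb : ℂ, ξa ≠ ξb → v ξa = v ξb →
      ∃ (σ : ℂ → ℂ) (N : Set ℂ), IsOpen N ∧ ξb ∈ N ∧ ContinuousOn σ N ∧
        (∀ ζ ∈ N, v ζ = v (σ ζ)) ∧ σ ξb = ξa) :
    IsClosed {ξ : ℂ | ∃ (ξ' : ℂ) (σ : ℂ → ℂ) (N : Set ℂ), ξ' ≠ ξ ∧ IsOpen N ∧ ξ ∈ N ∧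
      ContinuousOn σ N ∧ (∀ ζ ∈ N, v ζ = v (σ ζ)) ∧ σ ξ = ξ'} := by
  refine IsSeqClosed.isClosed ?_
  intro ξ ξs hmem hlim
  simp only [mem_setOf_eq] at hmem
  choose ξ' σ N hne _hN hξN _hσ hv hσξ using hmem
  -- the partners `ξ' k` have the same values as the `ξ k`
  have hvp : ∀ k, v (ξ' k) = v (ξ k) := fun k => by rw [hv k (ξ k) (hξN k), hσξ k]
  -- and they are bounded
  obtain ⟨C, hC⟩ := (Metric.isBounded_range_of_tendsto _
    (((P.continuous.comp hvc).tendsto ξs).comp hlim)).exists_norm_le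
  have hbd : ∀ k, ξ' k ∈ closedBall (0 : ℂ) (max ρ (C + 1)) := by
    intro k
    rw [mem_closedBall_zero_iff]
    have h1 : ‖ξ' k‖ ≤ max ρ (‖P (v (ξ' k))‖ + 1) :=
      norm_le_max_of_tail (fun η => P (v η)) ρ hρ (ξ' k)
    rw [hvp k] at h1
    have h2 : ‖P (v (ξ k))‖ ≤ C := hC _ ⟨k, rfl⟩
    exact h1.trans (max_le_max le_rfl (by linarith))
  -- hence they subconverge
  obtain ⟨ξs', -, φ, hφ, hlim'⟩ :=
    (isCompact_closedBall (0 : ℂ) (max ρ (C + 1))).tendsto_subseq hbd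
  -- the limit partner has the same value as the limit
  have hvs : v ξs' = v ξs := by
    refine tendsto_nhds_unique ((hvc.tendsto ξs').comp hlim') ?_
    have h3 : Tendsto (v ∘ ξ ∘ φ) atTop (𝓝 (v ξs)) :=
      (hvc.tendsto ξs).comp (hlim.comp hφ.tendsto_atTop)
    refine h3.congr fun k => ?_
    simp only [Function.comp_apply, hvp]
  by_cases hs : ξs' = ξs
  · -- impossible: `ξ (φ k)` and `ξ' (φ k)` are distinct, close to `ξs`, with equal values
    exfalso
    obtain ⟨r, hr, hinj⟩ := hli ξs
    have e1 : ∀ᶠ k in atTop, (ξ ∘ φ) k ∈ closedBall ξs r :=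
      (hlim.comp hφ.tendsto_atTop).eventually_mem (closedBall_mem_nhds ξs hr)
    have e2 : ∀ᶠ k in atTop, (ξ' ∘ φ) k ∈ closedBall ξs r := by
      rw [← hs]
      exact hlim'.eventually_mem (closedBall_mem_nhds ξs' hr)
    obtain ⟨k, hk1, hk2⟩ := (e1.and e2).exists
    exact hne (φ k) (hinj hk2 hk1 (hvp (φ k)))
  · obtain ⟨σ', N', hN', hξN', hσ', hv', hσξ'⟩ := h2 ξs' ξs hs hvs
    exact ⟨ξs', σ', N', hs, hN', hξN', hσ', hv', hσξ'⟩

end InjCoincide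

open InjCoincide in
/-- (GL) the global argument: a continuous proper-at-infinity curve, injective over the far lines,
locally injective, whose double points all come with local coincidence of sheets (or are
isolated), is injective — the coincidence set is clopen and misses the far region.

Proof: the set `A` of parameters with a distinct partner whose sheet locally coincides is open
(`InjCoincide.isOpen_coincideSet`) and closed (`InjCoincide.isClosed_coincideSet`); a double
point `v ξ₁ = v ξ₂`, `ξ₁ ≠ ξ₂`, puts `ξ₂ ∈ A`, so `A = ℂ` by connectedness; but a far real
parameter `t` (`ρ ≤ t`, `2R + 1 ≤ t`, so `2R < ‖P (v t)‖` by the tail estimate) lies in `A`,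
giving a partner `ξ' ≠ t` with `P (v ξ') = P (v t)`, against uniqueness over the far line. -/
theorem helper_injectiveOfCoincidenceStructure (v : ℂ → E4) (hvc : Continuous v)
    (P : E4 →L[ℝ] ℂ) (R : ℝ)
    (hprop : Tendsto (fun ξ => P (v ξ) - ξ) (cocompact ℂ) (𝓝 0))
    (hfar : ∀ c : ℂ, 2 * R < ‖c‖ → ∃! ξ, P (v ξ) = c)
    (hli : ∀ ξ : ℂ, ∃ r : ℝ, 0 < r ∧ InjOn v (closedBall ξ r))
    (h1 : ∀ ξa ξb : ℂ, v ξa = v ξb →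
      (∃ (σ : ℂ → ℂ) (N : Set ℂ), IsOpen N ∧ ξb ∈ N ∧ ContinuousOn σ N ∧
        (∀ ζ ∈ N, v ζ = v (σ ζ)) ∧ σ ξb = ξa) ∨
      (∃ ε r' : ℝ, 0 < ε ∧ 0 < r' ∧ ∀ ζ : ℂ, 0 < ‖ζ - ξb‖ → ‖ζ - ξb‖ ≤ ε →
        ∀ ζ' : ℂ, ‖ζ' - ξa‖ < r' → v ζ ≠ v ζ'))
    (h2 : ∀ ξa ξb : ℂ, ξa ≠ ξb → v ξa = v ξb →
      ∃ (σ : ℂ → ℂ) (N : Set ℂ), IsOpen N ∧ ξb ∈ N ∧ ContinuousOn σ N ∧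
        (∀ ζ ∈ N, v ζ = v (σ ζ)) ∧ σ ξb = ξa) :
    Function.Injective v := by
  obtain ⟨ρ, hρpos, hρ⟩ := exists_radius_tail (fun ξ => P (v ξ)) hprop
  intro ξ₁ ξ₂ heq
  by_contra hne
  -- the coincidence set
  set A : Set ℂ := {ξ : ℂ | ∃ (ξ' : ℂ) (σ : ℂ → ℂ) (N : Set ℂ), ξ' ≠ ξ ∧ IsOpen N ∧ ξ ∈ N ∧
      ContinuousOn σ N ∧ (∀ ζ ∈ N, v ζ = v (σ ζ)) ∧ σ ξ = ξ'}
  have hopen : IsOpen A := isOpen_coincideSet v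
  have hclosed : IsClosed A := isClosed_coincideSet v hvc P ρ hρ hli h2
  -- the double point puts `ξ₂ ∈ A`, with partner `ξ₁`
  have hξ₂ : ξ₂ ∈ A := by
    rcases h1 ξ₁ ξ₂ heq with ⟨σ, N, hN, hξN, hσ, hv, hσξ⟩ | _
    · exact ⟨ξ₁, σ, N, hne, hN, hξN, hσ, hv, hσξ⟩
    · obtain ⟨σ, N, hN, hξN, hσ, hv, hσξ⟩ := h2 ξ₁ ξ₂ hne heq
      exact ⟨ξ₁, σ, N, hne, hN, hξN, hσ, hv, hσξ⟩
  have huniv : A = univ := IsClopen.eq_univ ⟨hclosed, hopen⟩ ⟨ξ₂, hξ₂⟩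
  -- a far real parameter `t`
  obtain ⟨t, htρ, htR⟩ : ∃ t : ℝ, ρ ≤ t ∧ 2 * R + 1 ≤ t :=
    ⟨max ρ (2 * R + 1), le_max_left _ _, le_max_right _ _⟩
  have hnorm : ‖(t : ℂ)‖ = t := Complex.norm_of_nonneg (hρpos.le.trans htρ)
  have htail : ‖P (v (t : ℂ)) - (t : ℂ)‖ < 1 := hρ _ (by rw [hnorm]; exact htρ)
  have hbig : 2 * R < ‖P (v (t : ℂ))‖ := by
    have h3 : ‖(t : ℂ)‖ - ‖P (v (t : ℂ))‖ ≤ ‖(t : ℂ) - P (v (t : ℂ))‖ := norm_sub_norm_le _ _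
    rw [norm_sub_rev, hnorm] at h3
    linarith
  -- `t ∈ A` gives a distinct partner with the same value, against far injectivity
  have htA : (t : ℂ) ∈ A := by rw [huniv]; exact mem_univ _
  obtain ⟨ξ', σ, N, hne', -, hξN, -, hv, hσξ⟩ := htA
  have hval : v ξ' = v (t : ℂ) := by rw [hv _ hξN, hσξ]
  exact hne' ((hfar _ hbig).unique (show P (v ξ') = P (v (t : ℂ)) by rw [hval]) rfl)

end Summit.SmoothPoincare4.SmoothPoincare4.Cruxes.TameOrBrodyR4.Sketch
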